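import Summits.CriticalPhenomena.PercolationContinuityZ3.Theorems.PercNearOneGluingNoHeavyLowerTailSahiOneStepSubblockMediant
import HarnessLib

/-!
# One-step scheme, `(2′)` for sub-block thresholds — bookkeeping for the grid theorem

Support file (prover prim-ineq-prove-3 gen 20; `--supports stmt-CriticalPhenomena-4575`; memo
`run/shared/lean/prim/prim-ineq-prove-3/FINDING-G20-COUPLING-SPLIT.md` §2).  Pure finite-sum lemmas used by `…SubblockGrid`:
splitting / factoring of double `if`-sums (`dsum_split`, `dsum_row_factor`), the Step-2 band decomposition `step2_identity`
(`Ā·Σ_{H∩B} v − A·Σ_{H∩Bᶜ} v = T_v + R_v`), bands as differences of balls (`band_sum_eq_sub`) and antitonicity of the ball sums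
(`ball_sum_antitone`).
-/

namespace Summit.CriticalPhenomena.PercolationContinuityZ3.Theorems

namespace SahiOneStep

open Finset

/-! ## Bookkeeping for double `if`-sums -/

/-- Splitting a double `if`-sum by a further condition. [folklore] -/
theorem dsum_split (K J : ℕ) (P Q : ℕ → ℕ → Prop) [DecidablePred fun x : ℕ × ℕ => P x.1 x.2]
    [∀ k, DecidablePred (P k)] [∀ k, DecidablePred (Q k)] (f : ℕ → ℕ → ℝ) :
    (∑ k ∈ range K, ∑ j ∈ range J, if P k j then f k j else 0) =
      (∑ k ∈ range K, ∑ j ∈ range J, if P k j ∧ Q k j then f k j else 0) +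
        (∑ k ∈ range K, ∑ j ∈ range J, if P k j ∧ ¬ Q k j then f k j else 0) := by
  rw [← Finset.sum_add_distrib]
  refine Finset.sum_congr rfl fun k _ => ?_
  rw [← Finset.sum_add_distrib]
  refine Finset.sum_congr rfl fun j _ => ?_
  by_cases hP : P k j <;> by_cases hQ : Q k j <;> simp [hP, hQ]

/-- A double `if`-sum whose condition and summand factor through the row: `Σ_k Σ_j [P k] a_k b_j = (Σ_k [P k] a_k)(Σ_j b_j)`. [folklore] -/
theorem dsum_row_factor (K J : ℕ) (P : ℕ → Prop) [DecidablePred P] (a b : ℕ → ℝ) :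
    (∑ k ∈ range K, ∑ j ∈ range J, if P k then a k * b j else 0) =
      (∑ k ∈ range K, if P k then a k else 0) * (∑ j ∈ range J, b j) := by
  rw [Finset.sum_mul]
  refine Finset.sum_congr rfl fun k _ => ?_
  by_cases hP : P k
  · simp only [if_pos hP, Finset.mul_sum]
  · simp only [if_neg hP, Finset.sum_const_zero, zero_mul]

/-! ## Step 2: the band decomposition -/

/-- **Step 2 identity.**  For any array `v`, with `Ā = Σ_{k<r} a_k`, `A = Σ_{r≤k} a_k`:
`Ā·Σ_{H∩B} v − A·Σ_{H∩Bᶜ} v = T_v + R_v`, where `T_v = Σ_{k<r≤k'} a_k Σ_{t−k' ≤ j < t−k} v_{k'j}` (the band term) and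
`R_v = Σ_{k<r≤k'} Σ_{t ≤ k+j} (a_k v_{k'j} − a_{k'} v_{kj})`. [this work] -/
theorem step2_identity (K J : ℕ) (a : ℕ → ℝ) (v : ℕ → ℕ → ℝ) (r t : ℕ) :
    (∑ k ∈ range K, if k < r then a k else 0) * (∑ k' ∈ range K, ∑ j ∈ range J, if t ≤ k' + j ∧ r ≤ k' then v k' j else 0) -
      (∑ k' ∈ range K, if r ≤ k' then a k' else 0) * (∑ k ∈ range K, ∑ j ∈ range J, if t ≤ k + j ∧ ¬ r ≤ k then v k j else 0) =
    (∑ k ∈ range K, ∑ k' ∈ range K, ∑ j ∈ range J,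
        if k < r ∧ r ≤ k' ∧ t ≤ k' + j ∧ k + j < t then a k * v k' j else 0) +
      (∑ k ∈ range K, ∑ k' ∈ range K, ∑ j ∈ range J,
        if k < r ∧ r ≤ k' ∧ t ≤ k + j then a k * v k' j - a k' * v k j else 0) := by
  -- expand both products as triple sums in the order `k, k', j`
  have e1 : (∑ k ∈ range K, if k < r then a k else 0) *
      (∑ k' ∈ range K, ∑ j ∈ range J, if t ≤ k' + j ∧ r ≤ k' then v k' j else 0) =
      ∑ k ∈ range K, ∑ k' ∈ range K, ∑ j ∈ range J,
        if k < r ∧ r ≤ k' ∧ t ≤ k' + j then a k * v k' j else 0 := by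
    rw [Finset.sum_mul]
    refine Finset.sum_congr rfl fun k _ => ?_
    rw [Finset.mul_sum]
    refine Finset.sum_congr rfl fun k' _ => ?_
    rw [Finset.mul_sum]
    refine Finset.sum_congr rfl fun j _ => ?_
    by_cases hk : k < r <;> by_cases hk' : r ≤ k' <;> by_cases hj : t ≤ k' + j <;> simp [hk, hk', hj]
  have e2 : (∑ k' ∈ range K, if r ≤ k' then a k' else 0) *
      (∑ k ∈ range K, ∑ j ∈ range J, if t ≤ k + j ∧ ¬ r ≤ k then v k j else 0) =
      ∑ k ∈ range K, ∑ k' ∈ range K, ∑ j ∈ range J,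
        if k < r ∧ r ≤ k' ∧ t ≤ k + j then a k' * v k j else 0 := by
    have h0 : (∑ k' ∈ range K, if r ≤ k' then a k' else 0) *
        (∑ k ∈ range K, ∑ j ∈ range J, if t ≤ k + j ∧ ¬ r ≤ k then v k j else 0) =
        ∑ k' ∈ range K, ∑ k ∈ range K, ∑ j ∈ range J,
          if k < r ∧ r ≤ k' ∧ t ≤ k + j then a k' * v k j else 0 := by
      rw [Finset.sum_mul]
      refine Finset.sum_congr rfl fun k' _ => ?_
      rw [Finset.mul_sum]
      refine Finset.sum_congr rfl fun k _ => ?_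
      rw [Finset.mul_sum]
      refine Finset.sum_congr rfl fun j _ => ?_
      by_cases hk : r ≤ k <;> by_cases hk' : r ≤ k' <;> by_cases hj : t ≤ k + j
      all_goals first
        | (have hk2 : ¬ k < r := by omega
           simp [hk, hk', hj, hk2])
        | (have hk2 : k < r := by omega
           simp [hk, hk', hj, hk2])
    rw [h0, Finset.sum_comm]
  rw [e1, e2, ← Finset.sum_sub_distrib, ← Finset.sum_add_distrib]
  refine Finset.sum_congr rfl fun k _ => ?_
  rw [← Finset.sum_sub_distrib, ← Finset.sum_add_distrib]
  refine Finset.sum_congr rfl fun k' _ => ?_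
  rw [← Finset.sum_sub_distrib, ← Finset.sum_add_distrib]
  refine Finset.sum_congr rfl fun j _ => ?_
  by_cases hk : k < r
  · by_cases hk' : r ≤ k'
    · by_cases hj : t ≤ k + j
      · have hj' : t ≤ k' + j := by omega
        have hn : ¬ (k + j < t) := by omega
        simp [hk, hk', hj, hj', hn]
      · have hy : k + j < t := by omega
        by_cases hj' : t ≤ k' + j <;> simp [hk, hk', hj, hj', hy]
    · simp [hk, hk']
  · simp [hk]

/-! ## Column CDF of the row `m`: `F m = Σ_{m+j<t} b_j`, band weights, and their order relations -/

/-- The band `{t ≤ k'+j, k+j < t}` is the difference of two balls (`k ≤ k'`): `Σ_band f = Σ_{k+j<t} f − Σ_{k'+j<t} f`. [folklore] -/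
theorem band_sum_eq_sub (J : ℕ) (f : ℕ → ℝ) {k k' t : ℕ} (hkk' : k ≤ k') :
    (∑ j ∈ range J, if t ≤ k' + j ∧ k + j < t then f j else 0) =
      (∑ j ∈ range J, if k + j < t then f j else 0) - (∑ j ∈ range J, if k' + j < t then f j else 0) := by
  rw [← Finset.sum_sub_distrib]
  refine Finset.sum_congr rfl fun j _ => ?_
  by_cases h1 : k + j < t
  · by_cases h2 : k' + j < t
    · have h3 : ¬ t ≤ k' + j := by omega
      simp [h1, h2, h3]
    · have h3 : t ≤ k' + j := by omega
      simp [h1, h2, h3]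
  · have h2 : ¬ k' + j < t := by omega
    simp [h1, h2]

/-- The ball sums `F m = Σ_{m+j<t} f_j` (`f ≥ 0`) are nonincreasing in `m`. [folklore] -/
theorem ball_sum_antitone (J : ℕ) (f : ℕ → ℝ) (hf : ∀ j, 0 ≤ f j) {m m' t : ℕ} (hmm' : m ≤ m') :
    (∑ j ∈ range J, if m' + j < t then f j else 0) ≤ (∑ j ∈ range J, if m + j < t then f j else 0) := by
  refine Finset.sum_le_sum fun j _ => ?_
  by_cases h1 : m' + j < t
  · have h2 : m + j < t := by omega
    simp [h1, h2]
  · by_cases h2 : m + j < t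
    · simp [h1, h2, hf j]
    · simp [h1, h2]

end SahiOneStep

end Summit.CriticalPhenomena.PercolationContinuityZ3.Theorems
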